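import Literature.Analysis.FluidPDE.LocalBiotSavartLogLocalEnergy
import Literature.Analysis.FluidPDE.ExtremeGrowthVorticityControl
import Literature.Analysis.FunctionSpaces.TorusHolderHalfExplicit
import Literature.Analysis.FunctionSpaces.TorusPeriodization
import Literature.Analysis.FunctionSpaces.TorusInverseLaplacianCalculus
import Literature.Analysis.FunctionSpaces.HolderNormTorusProofs
import HarnessLib

/-!
# The Beale–Kato–Majda logarithmic gradient bound on the periodic box `T³`

Analysis/FluidPDE proof file (theorems only, no definitions, no named facts). For a smooth
divergence-free vector field `u` on the unit torus `T³ = (ℝ/ℤ)³` with vorticity `ω = curl u`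
bounded by `Ω` (`|ω(x)|² = torusVorticitySqAt u x ≤ Ω²`), we prove the periodic form of the
potential-theory estimate behind the Beale–Kato–Majda criterion — Doering–Gibbon 1995, Thm. 7.5
("valid for the periodic domain `[0, L]³`", a reworking of Beale–Kato–Majda 1984, (13)–(15);
Majda–Bertozzi 2002, Prop. 3.8, (3.83)–(3.87) on `ℝ³`):

* `Torus.exists_sqrt_gradSq_le_bkm_log` — **the `δ`-form** (Majda–Bertozzi (3.87) on `T³`): there
  is an absolute `C > 0` such that for every smooth divergence-free `u : T³ → ℝ³`, every `Ω ≥ 0`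
  with `|ω|² ≤ Ω²` pointwise, every `0 < δ ≤ 1` and every `x`,
  `|∇u(x)|_F ≤ C ( (‖∇Δu‖₂ + Ω) δ^{1/2} + Ω log(1/δ) + ‖u‖₂ )`,
  where `|∇u(x)|_F = (∑ᵢ ‖∂ᵢu(x)‖²)^{1/2}` is the Frobenius norm (the quantity the Functional-Mining
  cell bounds: `∀ x, ∑ i, ‖∂ᵢ u x‖² ≤ M²`), `‖∇Δu‖₂² = Torus.gradNormSq (Δu)` is the `H³` seminorm
  (`= D₃`, the palinstrophy dissipation) and `‖u‖₂² = ∫ ‖u‖²`;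
* `Torus.exists_sqrt_gradSq_le_bkm_log_homogeneous` — **the optimised form** (Beale–Kato–Majda
  (15) / Majda–Bertozzi (3.83) on `T³`, scale-free): for `Ω > 0`,
  `|∇u(x)|_F ≤ C ( Ω (1 + log(1 + ‖∇Δu‖₂/Ω)) + ‖u‖₂ )`.

Doering–Gibbon's printed form `‖Du‖_∞ ≤ c‖ω‖_∞[1 + log⁺ κ_{3,r}] + ‖ω‖₂` (`N = 3`, `r = 1, 2`,
`L = 1`) is deduced from the homogeneous form in the sequel `TorusBKMGradientLogBoundDG.lean`.

## The proof (periodisation of the tree's local Biot–Savart estimate)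

1. `FluidPDE.exists_opNorm_fderiv_le_log_local` (`LocalBiotSavartLogLocalEnergy`) — the tree's
   whole-space logarithmic estimate (Majda–Bertozzi Prop. 3.8 / (3.87)) with the LOCAL energy
   `‖v‖_{L²(B(x,3))}` and no integrability hypothesis, hence applicable to a periodic field.
2. Transfer `T³ → ℝ³` for the lift `V = u ∘ proj` (`Torus.lift`): `V` is smooth and divergence
   free (`Torus.isDivFree_lift`); `‖curl V(y)‖² = |ω(proj y)|²` (`Torus.norm_curl_lift_sq`);
   `curl V` is `½`-Hölder with constant `(2 D₃)^{1/2}`, `D₃ = ‖∇Δu‖₂²`, by the sharp Hölder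
   embedding of `TorusHolderHalfExplicit` applied to each `∂ⱼu` (`Torus.holderWith_curl_lift`);
   the local energy of the lift is at most `#window · ‖u‖₂²` (`Torus.setIntegral_ball_norm_sq_lift_le`,
   from `Torus.setLIntegral_lift_le`); and `∑ᵢ‖∂ᵢu(proj y)‖² ≤ 3‖DV(y)‖²`
   (`Torus.sum_norm_sq_partialDeriv_le_three_mul`).
3. Assembly at the representative `y = repr x ∈ [0,1)³` of `x ∈ T³`, and the choice
   `δ = (Ω/(‖∇Δu‖₂ + Ω))²` for the homogeneous form.

## Mathlib / tree search

Tree (all used): `FluidPDE.exists_opNorm_fderiv_le_log_local` (`LocalBiotSavartLogLocalEnergy`);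
`FluidPDE.curl` (`VectorCalculus`); `Torus.lift`, `Torus.repr`, `Torus.proj_repr`, `Torus.fderiv_lift`,
`Torus.partialDeriv_eq_fderiv_apply`, `Torus.isDivFree_iff_trace_fderiv_lift` (`TorusCalculus`),
`Torus.setLIntegral_lift_le`, `Torus.norm_le_card_of_mem_unitCube` (`TorusPeriodization`),
`Torus.partialDeriv_laplacian_comm` (`TorusInverseLaplacianCalculus`),
`Torus.norm_sub_le_sqrt_laplacian_sq_mul_sqrt_dist` (`TorusHolderHalfExplicit`),
`Torus.lipschitzWith_proj` (`HolderNormTorusProofs`), `FunctionSpaces.holderWith_of_dist_le`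
(`HolderAlgebra`), `FluidPDE.torusVorticitySqAt` (`ExtremeGrowthVorticityControl`). A periodic
BKM-type gradient bound did not exist in the tree (searched `log` under `FunctionSpaces/Torus*`,
`BKM`, `bkm`, `opNorm_fderiv_le` — only the `ℝ³` statements of `LocalBiotSavartLog` /
`NSVorticityBKMProofs` and the periodic-cylinder estimate of `PeriodicCylinderLogDivCurl`).

## References

* C. R. Doering, J. D. Gibbon, *Applied Analysis of the Navier–Stokes Equations*, CUP 1995, §7.5,
  Thm. 7.5 and its proof (book pp. 152–153). [DoeringGibbon1995]
* J. T. Beale, T. Kato, A. Majda, *Remarks on the breakdown of smooth solutions for the 3-D Euler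
  equations*, Comm. Math. Phys. 94 (1984) 61–66, (13)–(15). [BealeKatoMajda1984]
* A. J. Majda, A. L. Bertozzi, *Vorticity and Incompressible Flow*, CUP 2002, §3.3, Prop. 3.8,
  (3.83)–(3.87) (pp. 116–117). [MajdaBertozzi2002]
-/

noncomputable section

open MeasureTheory Set Function Filter Metric Real
open _root_.Topology
open scoped NNReal ENNReal ContDiff

/-! ## Part 1. Transfer from `T³` to the periodic lift on `ℝ³` -/

namespace Literature.Analysis.FunctionSpaces

namespace Torus

open UnitAddTorus

/-- The periodic lift of a `C¹` divergence-free field on `T³` is divergence free on `ℝ³`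
(`Torus.isDivFree_iff_trace_fderiv_lift`). [cite: DoeringGibbon1995, §7.5 Thm. 7.5 (periodic setting)] -/
theorem isDivFree_lift {u : (UnitAddTorus (Fin 3)) → (EuclideanSpace ℝ (Fin 3))} (hu : IsContDiff 1 u) (hdiv : IsDivFree u) :
    FluidPDE.VectorCalculus.IsDivFree (lift u) :=
  fun y => (isDivFree_iff_trace_fderiv_lift hu).1 hdiv y

/-- The entries of the velocity gradient of the lift are the torus partial derivatives:
`D(lift u)(y)[eⱼ] = ∂ⱼu (proj y)`. [folklore] -/
private theorem fderiv_lift_single {u : (UnitAddTorus (Fin 3)) → (EuclideanSpace ℝ (Fin 3))} (hu : IsContDiff 1 u) (y : (EuclideanSpace ℝ (Fin 3))) (j : Fin 3) :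
    _root_.fderiv ℝ (lift u) y (EuclideanSpace.single j 1) = partialDeriv j u (proj y) := by
  rw [fderiv_lift, partialDeriv_eq_fderiv_apply hu]

/-- **`|curl (lift u)(y)|² = |ω(proj y)|²`**: the squared norm of the curl of the lift is the
torus vorticity magnitude `torusVorticitySqAt u` (both are the sum of the squares of
`∂₂u₃ − ∂₃u₂, ∂₃u₁ − ∂₁u₃, ∂₁u₂ − ∂₂u₁`). [cite: MajdaBertozzi2002, §1.4 eq. (1.31)] -/
theorem norm_curl_lift_sq {u : (UnitAddTorus (Fin 3)) → (EuclideanSpace ℝ (Fin 3))} (hu : IsContDiff 1 u) (y : (EuclideanSpace ℝ (Fin 3))) :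
    ‖FluidPDE.curl (lift u) y‖ ^ 2 = FluidPDE.torusVorticitySqAt u (proj y) := by
  rw [EuclideanSpace.norm_sq_eq]
  simp only [FluidPDE.curl, FluidPDE.torusVorticitySqAt, fderiv_lift_single hu, PiLp.toLp_apply,
    Fin.sum_univ_three, Matrix.cons_val_zero, Matrix.cons_val_one, Matrix.cons_val_two,
    Matrix.head_cons, Matrix.tail_cons, Real.norm_eq_abs, sq_abs, Fin.isValue]
  ring

/-- The curl of the lift is bounded by any pointwise vorticity majorant `Ω` of `u`. [folklore] -/
private theorem norm_curl_lift_le {u : (UnitAddTorus (Fin 3)) → (EuclideanSpace ℝ (Fin 3))} (hu : IsContDiff 1 u) {Ω : ℝ} (hΩ0 : 0 ≤ Ω)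
    (hΩ : ∀ x, FluidPDE.torusVorticitySqAt u x ≤ Ω ^ 2) (y : (EuclideanSpace ℝ (Fin 3))) :
    ‖FluidPDE.curl (lift u) y‖ ≤ Ω := by
  have h : ‖FluidPDE.curl (lift u) y‖ ^ 2 ≤ Ω ^ 2 := by
    rw [norm_curl_lift_sq hu]; exact hΩ _
  exact (pow_le_pow_iff_left₀ (norm_nonneg _) hΩ0 two_ne_zero).1 h

/-- **Differences of the curl of the lift are controlled by differences of the gradient**:
`‖curl V(y) − curl V(y')‖² ≤ 2 ∑ⱼ ‖∂ⱼu(proj y) − ∂ⱼu(proj y')‖²` (`(a − b)² ≤ 2a² + 2b²` entry by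
entry). [folklore] -/
private theorem norm_curl_lift_sub_sq_le {u : (UnitAddTorus (Fin 3)) → (EuclideanSpace ℝ (Fin 3))} (hu : IsContDiff 1 u) (y y' : (EuclideanSpace ℝ (Fin 3))) :
    ‖FluidPDE.curl (lift u) y - FluidPDE.curl (lift u) y'‖ ^ 2 ≤
      2 * ∑ j, ‖partialDeriv j u (proj y) - partialDeriv j u (proj y')‖ ^ 2 := by
  simp_rw [EuclideanSpace.norm_sq_eq]
  simp only [FluidPDE.curl, fderiv_lift_single hu, PiLp.sub_apply,
    Fin.sum_univ_three, Matrix.cons_val_zero, Matrix.cons_val_one, Matrix.cons_val_two,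
    Matrix.head_cons, Matrix.tail_cons, Real.norm_eq_abs, sq_abs, Fin.isValue]
  nlinarith [sq_nonneg ((partialDeriv 1 u (proj y) 2 - partialDeriv 1 u (proj y') 2) +
      (partialDeriv 2 u (proj y) 1 - partialDeriv 2 u (proj y') 1)),
    sq_nonneg ((partialDeriv 2 u (proj y) 0 - partialDeriv 2 u (proj y') 0) +
      (partialDeriv 0 u (proj y) 2 - partialDeriv 0 u (proj y') 2)),
    sq_nonneg ((partialDeriv 0 u (proj y) 1 - partialDeriv 0 u (proj y') 1) +
      (partialDeriv 1 u (proj y) 0 - partialDeriv 1 u (proj y') 0)),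
    sq_nonneg (partialDeriv 0 u (proj y) 0 - partialDeriv 0 u (proj y') 0),
    sq_nonneg (partialDeriv 1 u (proj y) 1 - partialDeriv 1 u (proj y') 1),
    sq_nonneg (partialDeriv 2 u (proj y) 2 - partialDeriv 2 u (proj y') 2)]

/-- `∑ⱼ ‖Δ∂ⱼu‖₂² = ‖∇Δu‖₂²` (`Δ∂ⱼ = ∂ⱼΔ` on smooth fields). [folklore] -/
private theorem sum_integral_norm_sq_laplacian_partialDeriv {u : (UnitAddTorus (Fin 3)) → (EuclideanSpace ℝ (Fin 3))} (hu : IsSmooth u) :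
    ∑ j, ∫ x, ‖laplacian (partialDeriv j u) x‖ ^ 2 = gradNormSq (laplacian u) := by
  rw [gradNormSq, integral_finsetSum _ (f := fun i x => ‖partialDeriv i (laplacian u) x‖ ^ 2)
    fun i _ => ((hu.laplacian.partialDeriv i).continuous.norm.pow 2).integrable_unitAddTorus]
  refine Finset.sum_congr rfl fun j _ => integral_congr_ae (Eventually.of_forall fun x => ?_)
  simp only [partialDeriv_laplacian_comm hu j x]

/-- **The curl of the lift is `½`-Hölder with constant `(2‖∇Δu‖₂²)^{1/2}`** (the sharp Hölder
embedding `Ḣ²(T³) ⊂ C^{1/2}` of `TorusHolderHalfExplicit` for each `∂ⱼu`, and `proj` is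
`1`-Lipschitz). [cite: MajdaBertozzi2002, §3.3 proof of Prop. 3.8 ("Sobolev inequality (3.30) implies ‖ω‖_γ ≤ c‖ω‖") (p. 117)] -/
theorem holderWith_curl_lift {u : (UnitAddTorus (Fin 3)) → (EuclideanSpace ℝ (Fin 3))} (hu : IsSmooth u) :
    HolderWith (Real.sqrt (2 * gradNormSq (laplacian u))).toNNReal (1 / 2)
      (FluidPDE.curl (lift u)) := by
  have h1 : IsContDiff 1 u := hu.isContDiff (by simp)
  have hd : Fintype.card (Fin 3) = 3 := Fintype.card_fin 3
  set D3 : ℝ := gradNormSq (laplacian u) with hD3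
  have hD30 : 0 ≤ D3 := by
    rw [hD3, gradNormSq]; exact integral_nonneg fun x => Finset.sum_nonneg fun i _ => sq_nonneg _
  refine FunctionSpaces.holderWith_of_dist_le fun y y' => ?_
  rw [dist_eq_norm, Real.coe_toNNReal _ (Real.sqrt_nonneg _)]
  have hexp : (((1 / 2 : ℝ≥0) : ℝ)) = 1 / 2 := by norm_num
  rw [hexp]
  -- each gradient entry: `‖∂ⱼu(py) − ∂ⱼu(py')‖² ≤ ‖Δ∂ⱼu‖₂² · dist(py, py')`
  set t : ℝ := dist (proj y) (proj y') with ht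
  have ht0 : 0 ≤ t := dist_nonneg
  have htle : t ≤ dist y y' := by
    have := lipschitzWith_proj.dist_le_mul y y'
    simpa [ht] using this
  have hj : ∀ j : Fin 3, ‖partialDeriv j u (proj y) - partialDeriv j u (proj y')‖ ^ 2 ≤
      (∫ x, ‖laplacian (partialDeriv j u) x‖ ^ 2) * t := by
    intro j
    have h := norm_sub_le_sqrt_laplacian_sq_mul_sqrt_dist hd (hu.partialDeriv j) (proj y) (proj y')
    have hP0 : 0 ≤ ∫ x, ‖laplacian (partialDeriv j u) x‖ ^ 2 := integral_nonneg fun x => sq_nonneg _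
    have h2 := pow_le_pow_left₀ (norm_nonneg _) h 2
    refine h2.trans (le_of_eq ?_)
    rw [mul_pow, Real.sq_sqrt hP0, ← Real.sqrt_eq_rpow, Real.sq_sqrt ht0]
  have hsum : ‖FluidPDE.curl (lift u) y - FluidPDE.curl (lift u) y'‖ ^ 2 ≤ 2 * D3 * dist y y' := by
    calc ‖FluidPDE.curl (lift u) y - FluidPDE.curl (lift u) y'‖ ^ 2
        ≤ 2 * ∑ j, ‖partialDeriv j u (proj y) - partialDeriv j u (proj y')‖ ^ 2 :=
          norm_curl_lift_sub_sq_le h1 y y'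
      _ ≤ 2 * ∑ j, (∫ x, ‖laplacian (partialDeriv j u) x‖ ^ 2) * t := by
          gcongr with j _; exact hj j
      _ = 2 * D3 * t := by rw [← Finset.sum_mul, sum_integral_norm_sq_laplacian_partialDeriv hu]; ring
      _ ≤ 2 * D3 * dist y y' := by gcongr
  have hR0 : 0 ≤ Real.sqrt (2 * D3) * dist y y' ^ (1 / 2 : ℝ) := by positivity
  calc ‖FluidPDE.curl (lift u) y - FluidPDE.curl (lift u) y'‖
      = Real.sqrt (‖FluidPDE.curl (lift u) y - FluidPDE.curl (lift u) y'‖ ^ 2) :=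
        (Real.sqrt_sq (norm_nonneg _)).symm
    _ ≤ Real.sqrt (2 * D3 * dist y y') := Real.sqrt_le_sqrt hsum
    _ = Real.sqrt (2 * D3) * dist y y' ^ (1 / 2 : ℝ) := by
        rw [Real.sqrt_mul (by positivity), Real.sqrt_eq_rpow (dist y y')]

/-- **Local energy of the lift**: for a centre `c` with `‖c‖ ≤ 3`,
`∫_{B(c,3)} ‖u ∘ proj‖² ≤ #window · ∫_{T³} ‖u‖²`, the window being the lattice points `|kᵢ| ≤ 7`
(the ball lies in `B̄(0, 6)`, covered by those translates of the unit cube;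
`Torus.setLIntegral_lift_le`). [folklore] -/
private theorem setIntegral_ball_norm_sq_lift_le {u : (UnitAddTorus (Fin 3)) → (EuclideanSpace ℝ (Fin 3))} (hu : Continuous u) {c : (EuclideanSpace ℝ (Fin 3))}
    (hc : ‖c‖ ≤ 3) :
    ∫ z in ball c 3, ‖lift u z‖ ^ 2 ≤ (latticeWindow (Fin 3) 7).card * ∫ x, ‖u x‖ ^ 2 := by
  have hB : ball c 3 ⊆ closedBall (0 : (EuclideanSpace ℝ (Fin 3))) 6 := by
    intro z hz
    rw [mem_ball, dist_eq_norm] at hz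
    rw [mem_closedBall, dist_zero_right]
    calc ‖z‖ = ‖(z - c) + c‖ := by rw [sub_add_cancel]
      _ ≤ ‖z - c‖ + ‖c‖ := norm_add_le _ _
      _ ≤ 6 := by linarith
  have hmeas : AEMeasurable (fun x => ‖u x‖ₑ ^ 2) volume :=
    (hu.enorm.measurable.pow_const 2).aemeasurable
  have h := setLIntegral_lift_le (H := fun x => ‖u x‖ₑ ^ 2) hmeas hB (n := 7) (by norm_num)
  -- identify the integrands: `‖w‖ₑ² = ofReal (‖w‖²)`
  have hpt : ∀ w : (EuclideanSpace ℝ (Fin 3)), ‖w‖ₑ ^ 2 = ENNReal.ofReal (‖w‖ ^ 2) := fun w => by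
    rw [← ofReal_norm, ENNReal.ofReal_pow (norm_nonneg _)]
  have hlift : (fun z => lift (fun x => ‖u x‖ₑ ^ 2) z) = fun z => ENNReal.ofReal (‖lift u z‖ ^ 2) := by
    funext z; rw [lift_apply, lift_apply, hpt]
  have hint : Integrable (fun x => ‖u x‖ ^ 2) volume := (hu.norm.pow 2).integrable_unitAddTorus
  have hfin : ∫⁻ x, ‖u x‖ₑ ^ 2 ≠ ⊤ := by
    have h1 := hint.hasFiniteIntegral
    rw [HasFiniteIntegral] at h1
    have h2 : (fun x => ‖u x‖ₑ ^ 2) = fun x => ‖‖u x‖ ^ 2‖ₑ := by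
      funext x; rw [hpt, Real.enorm_eq_ofReal (sq_nonneg _)]
    rw [h2]; exact h1.ne
  -- the real integrals as `toReal` of the Lebesgue integrals
  have hcont : Continuous fun z : (EuclideanSpace ℝ (Fin 3)) => ‖lift u z‖ ^ 2 := ((continuous_lift_iff.2 hu).norm).pow 2
  have hLHS : ∫ z in ball c 3, ‖lift u z‖ ^ 2 =
      (∫⁻ z in ball c 3, ENNReal.ofReal (‖lift u z‖ ^ 2)).toReal :=
    integral_eq_lintegral_of_nonneg_ae (Eventually.of_forall fun z => sq_nonneg _)
      hcont.aestronglyMeasurable.restrict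
  have hRHS : ∫ x, ‖u x‖ ^ 2 = (∫⁻ x, ‖u x‖ₑ ^ 2).toReal := by
    rw [integral_eq_lintegral_of_nonneg_ae (Eventually.of_forall fun x => sq_nonneg _)
      ((hu.norm).pow 2).aestronglyMeasurable]
    congr 1
    exact lintegral_congr fun x => (hpt (u x)).symm
  rw [hLHS, hRHS, ← ENNReal.toReal_natCast, ← ENNReal.toReal_mul]
  refine ENNReal.toReal_mono (ENNReal.mul_ne_top (ENNReal.natCast_ne_top _) hfin) ?_
  calc ∫⁻ z in ball c 3, ENNReal.ofReal (‖lift u z‖ ^ 2)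
      = ∫⁻ z in ball c 3, lift (fun x => ‖u x‖ₑ ^ 2) z := by rw [hlift]
    _ ≤ (latticeWindow (Fin 3) 7).card * ∫⁻ x, ‖u x‖ₑ ^ 2 := h

/-- **Frobenius versus operator norm**: `∑ᵢ ‖∂ᵢu(proj y)‖² ≤ 3 ‖D(lift u)(y)‖²`
(`∂ᵢu(proj y) = D(lift u)(y)[eᵢ]` and `‖eᵢ‖ = 1`). [folklore] -/
private theorem sum_norm_sq_partialDeriv_le_three_mul {u : (UnitAddTorus (Fin 3)) → (EuclideanSpace ℝ (Fin 3))} (hu : IsContDiff 1 u) (y : (EuclideanSpace ℝ (Fin 3))) :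
    ∑ i, ‖partialDeriv i u (proj y)‖ ^ 2 ≤ 3 * ‖_root_.fderiv ℝ (lift u) y‖ ^ 2 := by
  have hi : ∀ i : Fin 3, ‖partialDeriv i u (proj y)‖ ^ 2 ≤ ‖_root_.fderiv ℝ (lift u) y‖ ^ 2 := by
    intro i
    rw [← fderiv_lift_single hu y i]
    refine pow_le_pow_left₀ (norm_nonneg _) ?_ 2
    calc ‖_root_.fderiv ℝ (lift u) y (EuclideanSpace.single i 1)‖
        ≤ ‖_root_.fderiv ℝ (lift u) y‖ * ‖EuclideanSpace.single i (1 : ℝ)‖ :=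
          ContinuousLinearMap.le_opNorm _ _
      _ = ‖_root_.fderiv ℝ (lift u) y‖ := by rw [EuclideanSpace.single, PiLp.norm_single, norm_one, mul_one]
  calc ∑ i, ‖partialDeriv i u (proj y)‖ ^ 2 ≤ ∑ _i : Fin 3, ‖_root_.fderiv ℝ (lift u) y‖ ^ 2 :=
        Finset.sum_le_sum fun i _ => hi i
    _ = 3 * ‖_root_.fderiv ℝ (lift u) y‖ ^ 2 := by simp

/-! ## Part 2. The periodic Beale–Kato–Majda gradient bound -/

/-- **The Beale–Kato–Majda logarithmic gradient bound on `T³`, `δ`-form** (Doering–Gibbon 1995,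
Thm. 7.5, in the parametrised form of Majda–Bertozzi (3.87) / Beale–Kato–Majda (13)–(14)): there is
an absolute constant `C > 0` such that for every smooth divergence-free `u : T³ → ℝ³`, every
`Ω ≥ 0` with `|curl u(x)|² ≤ Ω²` for all `x`, every `0 < δ ≤ 1` and every `x ∈ T³`,

  `(∑ᵢ ‖∂ᵢu(x)‖²)^{1/2} ≤ C ( (‖∇Δu‖₂ + Ω) δ^{1/2} + Ω log(1/δ) + ‖u‖₂ )`,

`‖∇Δu‖₂² = gradNormSq (Δu)`, `‖u‖₂² = ∫ ‖u‖²`. [cite: DoeringGibbon1995, §7.5 Thm. 7.5 and its proof, (7.5.13) (book pp. 152–153)] -/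
theorem exists_sqrt_gradSq_le_bkm_log :
    ∃ C : ℝ, 0 < C ∧ ∀ (u : (UnitAddTorus (Fin 3)) → (EuclideanSpace ℝ (Fin 3))), IsSmooth u → IsDivFree u →
      ∀ Ω : ℝ, 0 ≤ Ω → (∀ x, FluidPDE.torusVorticitySqAt u x ≤ Ω ^ 2) →
      ∀ δ : ℝ, 0 < δ → δ ≤ 1 → ∀ x : (UnitAddTorus (Fin 3)),
        Real.sqrt (∑ i, ‖partialDeriv i u x‖ ^ 2) ≤
          C * ((Real.sqrt (gradNormSq (laplacian u)) + Ω) * δ ^ (1 / 2 : ℝ) +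
            Ω * Real.log (1 / δ) + Real.sqrt (∫ z, ‖u z‖ ^ 2)) := by
  obtain ⟨C₀, hC₀, hlog⟩ := FluidPDE.exists_opNorm_fderiv_le_log_local
  set N : ℝ := ((latticeWindow (Fin 3) 7).card : ℝ) with hN
  have hN0 : 0 ≤ N := by rw [hN]; positivity
  refine ⟨Real.sqrt 3 * C₀ * (2 + Real.sqrt N) + 1, by positivity, ?_⟩
  intro u hu hdiv Ω hΩ0 hΩ δ hδ hδ1 x
  have h1 : IsContDiff 1 u := hu.isContDiff (by simp)
  have hV : ContDiff ℝ (↑(⊤ : ℕ∞)) (lift u) := hu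
  have hdivV : FluidPDE.VectorCalculus.IsDivFree (lift u) := isDivFree_lift h1 hdiv
  set D3 : ℝ := gradNormSq (laplacian u) with hD3
  have hD30 : 0 ≤ D3 := by
    rw [hD3, gradNormSq]; exact integral_nonneg fun x => Finset.sum_nonneg fun i _ => sq_nonneg _
  have hH := holderWith_curl_lift hu
  have hΩV : ∀ y, ‖FluidPDE.curl (lift u) y‖ ≤ Ω.toNNReal := fun y => by
    rw [Real.coe_toNNReal _ hΩ0]; exact norm_curl_lift_le h1 hΩ0 hΩ y
  -- the representative of `x` in the unit cube
  set y : (EuclideanSpace ℝ (Fin 3)) := repr x with hy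
  have hyn : ‖y‖ ≤ 3 := by
    have := norm_le_card_of_mem_unitCube (repr_mem_unitCube x)
    rw [Fintype.card_fin] at this
    exact_mod_cast this
  have hmain := hlog (lift u) hV hdivV _ _ hH hΩV δ hδ hδ1 y
  rw [Real.coe_toNNReal _ (Real.sqrt_nonneg _), Real.coe_toNNReal _ hΩ0] at hmain
  -- the pieces
  have hlog0 : 0 ≤ Real.log (1 / δ) := Real.log_nonneg ((one_le_div hδ).2 hδ1)
  have hd0 : 0 ≤ δ ^ (1 / 2 : ℝ) := Real.rpow_nonneg hδ.le _
  have hU0 : 0 ≤ Real.sqrt (∫ z, ‖u z‖ ^ 2) := Real.sqrt_nonneg _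
  have hloc : Real.sqrt (∫ z in ball y 3, ‖lift u z‖ ^ 2) ≤ Real.sqrt N * Real.sqrt (∫ z, ‖u z‖ ^ 2) := by
    rw [← Real.sqrt_mul hN0]
    exact Real.sqrt_le_sqrt (setIntegral_ball_norm_sq_lift_le hu.continuous hyn)
  have hfrob : Real.sqrt (∑ i, ‖partialDeriv i u x‖ ^ 2) ≤
      Real.sqrt 3 * ‖_root_.fderiv ℝ (lift u) y‖ := by
    have h := sum_norm_sq_partialDeriv_le_three_mul h1 y
    rw [hy, proj_repr] at h
    calc Real.sqrt (∑ i, ‖partialDeriv i u x‖ ^ 2)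
        ≤ Real.sqrt (3 * ‖_root_.fderiv ℝ (lift u) (repr x)‖ ^ 2) := Real.sqrt_le_sqrt h
      _ = Real.sqrt 3 * ‖_root_.fderiv ℝ (lift u) y‖ := by
          rw [Real.sqrt_mul (by norm_num), Real.sqrt_sq (norm_nonneg _)]
  have hsq2 : Real.sqrt (2 * D3) ≤ 2 * Real.sqrt D3 := by
    rw [Real.sqrt_mul (by norm_num)]
    have h2 : Real.sqrt 2 ≤ 2 := by
      have h := Real.sqrt_le_sqrt (show (2 : ℝ) ≤ 2 ^ 2 by norm_num)
      rwa [Real.sqrt_sq (by norm_num : (0 : ℝ) ≤ 2)] at h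
    exact mul_le_mul_of_nonneg_right h2 (Real.sqrt_nonneg _)
  -- the bracket of the whole-space estimate is at most `(2 + √N) X`
  set X : ℝ := (Real.sqrt D3 + Ω) * δ ^ (1 / 2 : ℝ) + Ω * Real.log (1 / δ) +
    Real.sqrt (∫ z, ‖u z‖ ^ 2) with hX
  have hX0 : 0 ≤ X := by positivity
  have hbr : (Real.sqrt (2 * D3) + Ω) * δ ^ (1 / 2 : ℝ) + Ω * Real.log (1 / δ) +
      Real.sqrt (∫ z in ball y 3, ‖lift u z‖ ^ 2) ≤ (2 + Real.sqrt N) * X := by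
    have hsN : 0 ≤ Real.sqrt N := Real.sqrt_nonneg _
    have hsD : 0 ≤ Real.sqrt D3 := Real.sqrt_nonneg _
    have a1 : (Real.sqrt (2 * D3) + Ω) * δ ^ (1 / 2 : ℝ) ≤ 2 * ((Real.sqrt D3 + Ω) * δ ^ (1 / 2 : ℝ)) := by
      nlinarith [mul_nonneg hΩ0 hd0, mul_nonneg hsD hd0]
    have a2 : Ω * Real.log (1 / δ) ≤ 2 * (Ω * Real.log (1 / δ)) := by
      nlinarith [mul_nonneg hΩ0 hlog0]
    have a3 : Real.sqrt (∫ z in ball y 3, ‖lift u z‖ ^ 2) ≤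
        Real.sqrt N * Real.sqrt (∫ z, ‖u z‖ ^ 2) := hloc
    rw [hX]
    nlinarith [a1, a2, a3, mul_nonneg hsN (mul_nonneg (add_nonneg hsD hΩ0) hd0),
      mul_nonneg hsN (mul_nonneg hΩ0 hlog0), mul_nonneg hU0 (show (0:ℝ) ≤ 2 by norm_num)]
  calc Real.sqrt (∑ i, ‖partialDeriv i u x‖ ^ 2)
      ≤ Real.sqrt 3 * ‖_root_.fderiv ℝ (lift u) y‖ := hfrob
    _ ≤ Real.sqrt 3 * (C₀ * ((Real.sqrt (2 * D3) + Ω) * δ ^ (1 / 2 : ℝ) + Ω * Real.log (1 / δ) +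
          Real.sqrt (∫ z in ball y 3, ‖lift u z‖ ^ 2))) :=
        mul_le_mul_of_nonneg_left hmain (Real.sqrt_nonneg _)
    _ ≤ Real.sqrt 3 * (C₀ * ((2 + Real.sqrt N) * X)) := by gcongr
    _ = (Real.sqrt 3 * C₀ * (2 + Real.sqrt N)) * X := by ring
    _ ≤ (Real.sqrt 3 * C₀ * (2 + Real.sqrt N) + 1) * X := by nlinarith

/-- **The Beale–Kato–Majda logarithmic gradient bound on `T³`, homogeneous form** (Beale–Kato–Majda
1984, (15); Majda–Bertozzi 2002, (3.83); Doering–Gibbon 1995, (7.5.13)–(7.5.14) with the splitting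
radius optimised): there is an absolute constant `C > 0` such that for every smooth
divergence-free `u : T³ → ℝ³`, every `Ω > 0` with `|curl u(x)|² ≤ Ω²` for all `x`, and every `x`,

  `(∑ᵢ ‖∂ᵢu(x)‖²)^{1/2} ≤ C ( Ω (1 + log(1 + ‖∇Δu‖₂/Ω)) + ‖u‖₂ )`.

(The choice `δ = (Ω/(‖∇Δu‖₂ + Ω))²` in `exists_sqrt_gradSq_le_bkm_log`.) [cite: DoeringGibbon1995, §7.5 Thm. 7.5 and its proof, (7.5.13)–(7.5.14) (book pp. 152–153)] -/
theorem exists_sqrt_gradSq_le_bkm_log_homogeneous :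
    ∃ C : ℝ, 0 < C ∧ ∀ (u : (UnitAddTorus (Fin 3)) → (EuclideanSpace ℝ (Fin 3))), IsSmooth u → IsDivFree u →
      ∀ Ω : ℝ, 0 < Ω → (∀ x, FluidPDE.torusVorticitySqAt u x ≤ Ω ^ 2) → ∀ x : (UnitAddTorus (Fin 3)),
        Real.sqrt (∑ i, ‖partialDeriv i u x‖ ^ 2) ≤
          C * (Ω * (1 + Real.log (1 + Real.sqrt (gradNormSq (laplacian u)) / Ω)) +
            Real.sqrt (∫ z, ‖u z‖ ^ 2)) := by
  obtain ⟨C, hC, h⟩ := exists_sqrt_gradSq_le_bkm_log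
  refine ⟨2 * C, by positivity, fun u hu hdiv Ω hΩ hΩb x => ?_⟩
  set S : ℝ := Real.sqrt (gradNormSq (laplacian u)) with hS
  have hS0 : 0 ≤ S := Real.sqrt_nonneg _
  have hSO : 0 < S + Ω := by positivity
  set δ : ℝ := (Ω / (S + Ω)) ^ 2 with hδ
  have hq0 : 0 < Ω / (S + Ω) := div_pos hΩ hSO
  have hq1 : Ω / (S + Ω) ≤ 1 := by rw [div_le_one hSO]; linarith
  have hδ0 : 0 < δ := by rw [hδ]; positivity
  have hδ1 : δ ≤ 1 := by
    rw [hδ]; nlinarith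
  have hmain := h u hu hdiv Ω hΩ.le hΩb δ hδ0 hδ1 x
  -- evaluate the choice of `δ`
  have hsqrtδ : δ ^ (1 / 2 : ℝ) = Ω / (S + Ω) := by
    rw [← Real.sqrt_eq_rpow, hδ, Real.sqrt_sq hq0.le]
  have hfirst : (S + Ω) * δ ^ (1 / 2 : ℝ) = Ω := by
    rw [hsqrtδ]; field_simp
  have hlogδ : Real.log (1 / δ) = 2 * Real.log (1 + S / Ω) := by
    have e : 1 / δ = (1 + S / Ω) ^ 2 := by
      rw [hδ]; field_simp; ring
    rw [e, Real.log_pow]; norm_num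
  rw [hfirst, hlogδ] at hmain
  have hL0 : 0 ≤ Real.log (1 + S / Ω) := Real.log_nonneg (by
    have : 0 ≤ S / Ω := div_nonneg hS0 hΩ.le
    linarith)
  have hU0 : 0 ≤ Real.sqrt (∫ z, ‖u z‖ ^ 2) := Real.sqrt_nonneg _
  calc Real.sqrt (∑ i, ‖partialDeriv i u x‖ ^ 2)
      ≤ C * (Ω + Ω * (2 * Real.log (1 + S / Ω)) + Real.sqrt (∫ z, ‖u z‖ ^ 2)) := hmain
    _ ≤ 2 * C * (Ω * (1 + Real.log (1 + S / Ω)) + Real.sqrt (∫ z, ‖u z‖ ^ 2)) := by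
        nlinarith [mul_nonneg hΩ.le hL0, hC.le]

end Torus

end Literature.Analysis.FunctionSpaces

end
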